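import Summits.ResolutionOfSingularities.ResolutionOfSingularities.Theorems.FrobeniusLadderFInjectiveMacaulayficationKLocCellSound
import HarnessLib

/-!
# `KLocCell` kernel checks are insensitive to the ORDER of the chart polynomial's term list (road B, U14 generator support)

[OURS · L1 W4.5a] Support file for crux stmt-ResolutionOfSingularities-15315 (res-L1-w45a-plan-1 BUILD SPEC v1.1/v1.2, R12.34a/R12.47/R12.51;
generator owner res-D-pv-040, U14).  `KLocCellKit.checkKs p G cells` (p518138) multiplies the RAW term list `G` only inside `cofactorNFK`'s
`mulK (withKey T₀) (withKey G)`, whose merge assumes `withKey G` KEY-SORTED; the TERM ORDER OF RECORD for the statements is tri-1's JSON order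
(= `T11Char7Poly.G c`, p522399), which is not key-sorted on most charts.  This file lets a cells file keep the JSON-order literal `G` in its
STATEMENT while the kernel check runs on any permutation `G'` (e.g. the key-sorted copy): `evalL K G` is a `List.sum` of a `List.map`, hence
invariant under `List.Perm` (`evalL_eq_of_perm`), and `klocCells_of_check_of_perm` transports `KLocCellKit.klocCells_of_check` (p519543) along it.
Needed only for cells with `t₀ ≠ 0` (the `gb-unit-lift` strata of `T⁽⁴⁾/7`); `const`/`empty` cells are encoded with `t₀ = 0` and are
order-blind already.  No definition; AI-written, weaker than expert review; no statement of [claim: Hironaka2017] is used. [folklore]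
-/

-- single-problem summit: the doubled namespace component is forced
set_option linter.dupNamespace false

noncomputable section

namespace Summit.ResolutionOfSingularities.ResolutionOfSingularities.Theorems.FInjectiveMacaulayfication.KLocCellKit

open MvPolynomial

variable {n : ℕ} (K : Type) [Field K]

/-- `evalL` is invariant under permutations of the term list. [folklore] -/
theorem evalL_eq_of_perm {G G' : List (ℤ × (Fin n → ℕ))} (h : G.Perm G') : evalL K G = evalL K G' := by
  unfold evalL
  exact (h.map _).sum_eq

/-- **Kernel cells from a check on ANY permutation of the term list**: if `G ~ G'` and `checkKs p G' cells = true`, the §3 cells binder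
holds for `g = evalL K G` (statement literal `G` in the order of record, kernel run on `G'`). [folklore] -/
theorem klocCells_of_check_of_perm (p : ℕ) [Fact p.Prime] [CharP K p] (G G' : List (ℤ × (Fin n → ℕ))) (hGG' : G.Perm G')
    (cells : List (Finset (Fin n) × List ((Fin n → ℕ) × List (ℤ × (Fin n → ℕ))) × (Fin n → List (ℤ × (Fin n → ℕ))) ×
      List (ℤ × (Fin n → ℕ))))
    (hcheck : checkKs p G' cells = true) :
    ∀ S ∈ cells.map Prod.fst, ∃ (L : List ((Fin n →₀ ℕ) × MvPolynomial (Fin n) K)) (rr : List (MvPolynomial (Fin n) K))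
      (t : Fin n → MvPolynomial (Fin n) K) (t₀ : MvPolynomial (Fin n) K),
      (L.map Prod.fst).Nodup ∧ (∀ e ∈ L, ∀ i : Fin n, e.1 i < p) ∧
      evalL K G ^ (p - 1) = (L.map fun e => MvPolynomial.monomial e.1 (1 : K) * MvPolynomial.expand p e.2).sum ∧
      (1 : MvPolynomial (Fin n) K) = (List.zipWith (fun r e => r * MvPolynomial.expand p e.2) rr L).sum +
        ∑ i ∈ S, t i * MvPolynomial.X i + t₀ * evalL K G := by
  rw [evalL_eq_of_perm K hGG']
  exact klocCells_of_check K p G' cells hcheck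

/-- The same with an explicit strata list `SS = cells.map Prod.fst` (lets a cells file state `∀ S ∈ SS` with a light literal and keep the
heavy `cells` literal inside the proof). [folklore] -/
theorem klocCells_of_check_of_perm' (p : ℕ) [Fact p.Prime] [CharP K p] (G G' : List (ℤ × (Fin n → ℕ))) (hGG' : G.Perm G')
    (SS : List (Finset (Fin n)))
    (cells : List (Finset (Fin n) × List ((Fin n → ℕ) × List (ℤ × (Fin n → ℕ))) × (Fin n → List (ℤ × (Fin n → ℕ))) ×
      List (ℤ × (Fin n → ℕ))))
    (hSS : cells.map Prod.fst = SS) (hcheck : checkKs p G' cells = true) :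
    ∀ S ∈ SS, ∃ (L : List ((Fin n →₀ ℕ) × MvPolynomial (Fin n) K)) (rr : List (MvPolynomial (Fin n) K))
      (t : Fin n → MvPolynomial (Fin n) K) (t₀ : MvPolynomial (Fin n) K),
      (L.map Prod.fst).Nodup ∧ (∀ e ∈ L, ∀ i : Fin n, e.1 i < p) ∧
      evalL K G ^ (p - 1) = (L.map fun e => MvPolynomial.monomial e.1 (1 : K) * MvPolynomial.expand p e.2).sum ∧
      (1 : MvPolynomial (Fin n) K) = (List.zipWith (fun r e => r * MvPolynomial.expand p e.2) rr L).sum +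
        ∑ i ∈ S, t i * MvPolynomial.X i + t₀ * evalL K G := by
  rw [← hSS]
  exact klocCells_of_check_of_perm K p G G' hGG' cells hcheck

/-- Explicit-strata-list form of `klocCells_of_check` itself (no permutation). [folklore] -/
theorem klocCells_of_check' (p : ℕ) [Fact p.Prime] [CharP K p] (G : List (ℤ × (Fin n → ℕ))) (SS : List (Finset (Fin n)))
    (cells : List (Finset (Fin n) × List ((Fin n → ℕ) × List (ℤ × (Fin n → ℕ))) × (Fin n → List (ℤ × (Fin n → ℕ))) ×
      List (ℤ × (Fin n → ℕ))))
    (hSS : cells.map Prod.fst = SS) (hcheck : checkKs p G cells = true) :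
    ∀ S ∈ SS, ∃ (L : List ((Fin n →₀ ℕ) × MvPolynomial (Fin n) K)) (rr : List (MvPolynomial (Fin n) K))
      (t : Fin n → MvPolynomial (Fin n) K) (t₀ : MvPolynomial (Fin n) K),
      (L.map Prod.fst).Nodup ∧ (∀ e ∈ L, ∀ i : Fin n, e.1 i < p) ∧
      evalL K G ^ (p - 1) = (L.map fun e => MvPolynomial.monomial e.1 (1 : K) * MvPolynomial.expand p e.2).sum ∧
      (1 : MvPolynomial (Fin n) K) = (List.zipWith (fun r e => r * MvPolynomial.expand p e.2) rr L).sum +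
        ∑ i ∈ S, t i * MvPolynomial.X i + t₀ * evalL K G := by
  rw [← hSS]
  exact klocCells_of_check K p G cells hcheck

end Summit.ResolutionOfSingularities.ResolutionOfSingularities.Theorems.FInjectiveMacaulayfication.KLocCellKit

end
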